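import Literature.Topology.FourManifolds.NonSeparatingSpheresCover
import Literature.Topology.FourManifolds.CylinderToSphere
import Literature.Topology.FourManifolds.SphereHypersurfaceSides
import HarnessLib

/-!
# Budney–Gabai Thm. 3.13: a defining function for a lifted sphere in the cyclic cover

Companion to `NonSeparatingSpheresCover.lean` (lift `ẽ : Sⁿ → ℝ × Sⁿ` of an embedded `n`-sphere
of `S¹ × Sⁿ`) and `CylinderToSphere.lean` (the embedding `ι : ℝ × Sⁿ ↪ Sⁿ⁺¹`), for the fact
seat of `Literature.Topology.FourManifolds.BudneyGabai2019_thm_3_13` (R. Budney, D. Gabai,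
*Knotted 3-balls in `S⁴`*, arXiv:1912.09029, Thm. 3.13).  The degree count for the dual circle
of a non-separating sphere (proof of Thm. 3.13, p. 22) reads the crossings of a lifted loop with
the lifted sphere `K̃ = ẽ(Sⁿ)` through the **sign of a defining function** `G : ℝ × Sⁿ → ℝ` of
`K̃`.  This file produces `G` (`BudneyGabai2019_thm_3_13.exists_sideFunction`) by pulling back
along `ι` the regular defining function `g : Sⁿ⁺¹ → ℝ` of the smooth hypersurface sphere
`ι ∘ ẽ : Sⁿ → Sⁿ⁺¹` given by the tree's Jordan–Brouwer theorem
(`SphereHypersurfaceSides.exists_isSidePackage`, `SphereHypersurfaceSides.lean`):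

* `G` is `C^∞` and vanishes exactly on `ẽ(Sⁿ)`;
* at every point `ẽ x` the differential `dG` is a nonzero linear form whose kernel is the
  tangent space `dẽ(T_x Sⁿ)` of the lifted sphere (regularity of `g`, `dι` an isomorphism,
  dimension count) — so an arc crossing `K̃` transversally at `ẽ x` has `(G ∘ arc)' ≠ 0` there;
* towards the two ends `t → ±∞` of the cylinder, `G` has eventually the (nonzero) signs
  `σ₊ = g(N)`, `σ₋ = g(S)` of `g` at the poles (`CylinderToSphere.dist_map_northPole_lt`,
  `…southPole_lt`), and if these signs agree the region `{σ₊ G ≤ 0}` is bounded in `t`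
  (it is the preimage of a compact set of `Sⁿ⁺¹` missing both poles).

Everything here is proved; no definition and no named fact is introduced.

## References

* R. Budney, D. Gabai, *Knotted 3-balls in `S⁴`*, arXiv:1912.09029 (v2), §3, proof of Thm. 3.13
  (p. 22). [BudneyGabai2019]
* M. W. Hirsch, *Differential Topology*, GTM 33 (1976), Ch. 4 §4 (separation by hypersurfaces).
  [HirschDT1976]
-/

noncomputable section

open scoped Manifold ContDiff Topology Real
open Set Function Metric Module Filter

namespace Literature.Topology.FourManifolds

namespace BudneyGabai2019_thm_3_13

variable {n : ℕ}

/-- **The kernel of a nonzero linear form containing an `n`-dimensional subspace of an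
`(n+1)`-dimensional space is that subspace.** [folklore] -/
private theorem ker_eq_of_le_of_finrank {V : Type*} [AddCommGroup V] [Module ℝ V]
    [FiniteDimensional ℝ V] {φ : V →ₗ[ℝ] ℝ} (hφ : φ ≠ 0) {S : Submodule ℝ V}
    (hS : S ≤ LinearMap.ker φ) (hdim : finrank ℝ S + 1 = finrank ℝ V) : LinearMap.ker φ = S := by
  symm
  refine Submodule.eq_of_le_of_finrank_eq hS ?_
  have hsurj : Function.Surjective φ := by
    intro r
    obtain ⟨v, hv⟩ : ∃ v, φ v ≠ 0 := by
      by_contra hall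
      push Not at hall
      exact hφ (LinearMap.ext hall)
    exact ⟨(r / φ v) • v, by rw [map_smul, smul_eq_mul, div_mul_cancel₀ r hv]⟩
  have h1 := LinearMap.finrank_range_add_finrank_ker φ
  rw [LinearMap.range_eq_top.2 hsurj, finrank_top, Module.finrank_self] at h1
  omega

/-- **A defining function for a lifted sphere in the cyclic cover.**  Let `ẽ : Sⁿ → ℝ × Sⁿ`,
`n ≥ 1`, be a smooth embedding (model `𝓘(ℝ, ℝ).prod (𝓡 n)`).  There is a `C^∞` function
`G : ℝ × Sⁿ → ℝ` with: `G q = 0 ↔ q ∈ ẽ(Sⁿ)`; at each `ẽ x`, `dG v = 0 ↔ v ∈ dẽ(T_x Sⁿ)`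
(so `dG ≠ 0` there and `ker dG` is the tangent space of the lifted sphere); and nonzero signs
`σ₊`, `σ₋` such that `σ₊ G > 0` for `t ≥ T`, `σ₋ G > 0` for `t ≤ -T` (uniformly in the `Sⁿ`
factor), and, if `σ₊ σ₋ > 0`, the set `{σ₊ G ≤ 0}` is bounded in `t`.  Construction: `G = g ∘ ι`
for the embedding `ι : ℝ × Sⁿ ↪ Sⁿ⁺¹` of `CylinderToSphere.lean` and the regular defining
function `g` of the hypersurface sphere `ι ∘ ẽ` (`SphereHypersurfaceSides.exists_isSidePackage`,
the tree's Jordan–Brouwer theorem); `σ₊ = g(N)`, `σ₋ = g(S)` are the values at the poles.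
[cite: HirschDT1976, Ch. 4 §4] -/
theorem exists_sideFunction (hn : 1 ≤ n)
    {el : Metric.sphere (0 : EuclideanSpace ℝ (Fin (n + 1))) 1 →
      ℝ × Metric.sphere (0 : EuclideanSpace ℝ (Fin (n + 1))) 1}
    (hel : Manifold.IsSmoothEmbedding (𝓡 n) (𝓘(ℝ, ℝ).prod (𝓡 n)) ∞ el) :
    ∃ G : ℝ × Metric.sphere (0 : EuclideanSpace ℝ (Fin (n + 1))) 1 → ℝ,
      ContMDiff (𝓘(ℝ, ℝ).prod (𝓡 n)) 𝓘(ℝ, ℝ) ∞ G ∧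
      (∀ q, G q = 0 ↔ q ∈ range el) ∧
      (∀ (x : Metric.sphere (0 : EuclideanSpace ℝ (Fin (n + 1))) 1)
          (v : TangentSpace (𝓘(ℝ, ℝ).prod (𝓡 n)) (el x)),
        mfderiv (𝓘(ℝ, ℝ).prod (𝓡 n)) 𝓘(ℝ, ℝ) G (el x) v = 0 ↔
          v ∈ (mfderiv (𝓡 n) (𝓘(ℝ, ℝ).prod (𝓡 n)) el x).range) ∧
      ∃ σp σm : ℝ, σp ≠ 0 ∧ σm ≠ 0 ∧
        (∃ T : ℝ, ∀ q, T ≤ q.1 → 0 < σp * G q) ∧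
        (∃ T : ℝ, ∀ q, q.1 ≤ T → 0 < σm * G q) ∧
        (0 < σp * σm → ∃ T : ℝ, ∀ q, σp * G q ≤ 0 → |q.1| ≤ T) := by
  haveI : Fact (finrank ℝ (EuclideanSpace ℝ (Fin (n + 1))) = n + 1) := ⟨finrank_euclideanSpace_fin⟩
  haveI : Fact (finrank ℝ (EuclideanSpace ℝ (Fin (n + 1 + 1))) = n + 1 + 1) :=
    ⟨finrank_euclideanSpace_fin⟩
  -- ### the hypersurface sphere `ι ∘ ẽ` of `Sⁿ⁺¹` and its defining function
  set ι := CylinderToSphere.map n with hι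
  have hK : Manifold.IsSmoothEmbedding (𝓡 n) (𝓡 (n + 1)) ∞ (ι ∘ el) :=
    CylinderToSphere.isSmoothEmbedding_map_comp n hel
  obtain ⟨g, hg⟩ := SphereHypersurfaceSides.exists_isSidePackage hn hK
  have hgs : ContMDiff (𝓡 (n + 1)) 𝓘(ℝ, ℝ) ∞ g := hg.isRegularLevel.contMDiff
  have hgc : Continuous g := hgs.continuous
  have hg0 : ∀ z, g z = 0 ↔ z ∈ range (ι ∘ el) := fun z ↦ by
    rw [← hg.preimage_zero]
    rfl
  set G : ℝ × Metric.sphere (0 : EuclideanSpace ℝ (Fin (n + 1))) 1 → ℝ := g ∘ ι with hG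
  have hιs := CylinderToSphere.contMDiff_map n
  have hGs : ContMDiff (𝓘(ℝ, ℝ).prod (𝓡 n)) 𝓘(ℝ, ℝ) ∞ G := hgs.comp hιs
  -- `G = 0` exactly on the lifted sphere
  have hG0 : ∀ q, G q = 0 ↔ q ∈ range el := fun q ↦ by
    rw [hG, comp_apply, hg0, range_comp]
    exact (CylinderToSphere.injective_map n).mem_set_image
  -- values at the poles
  set σp : ℝ := g (CylinderToSphere.northPole n) with hσp
  set σm : ℝ := g (CylinderToSphere.southPole n) with hσm
  have hσp0 : σp ≠ 0 := by
    intro h0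
    obtain ⟨x, hx⟩ := (hg0 _).1 h0
    exact CylinderToSphere.map_ne_northPole n (el x) hx
  have hσm0 : σm ≠ 0 := by
    intro h0
    obtain ⟨x, hx⟩ := (hg0 _).1 h0
    exact CylinderToSphere.map_ne_southPole n (el x) hx
  refine ⟨G, hGs, hG0, fun x v ↦ ?_, σp, σm, hσp0, hσm0, ?_, ?_, fun hsame ↦ ?_⟩
  · -- ### the kernel of `dG` at `ẽ x` is the tangent space of the lifted sphere
    haveI : FiniteDimensional ℝ (TangentSpace (𝓘(ℝ, ℝ).prod (𝓡 n)) (el x)) :=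
      inferInstanceAs (FiniteDimensional ℝ (ℝ × EuclideanSpace ℝ (Fin n)))
    haveI : FiniteDimensional ℝ (TangentSpace (𝓡 (n + 1)) (ι (el x))) :=
      inferInstanceAs (FiniteDimensional ℝ (EuclideanSpace ℝ (Fin (n + 1))))
    haveI : FiniteDimensional ℝ (TangentSpace (𝓡 n) x) :=
      inferInstanceAs (FiniteDimensional ℝ (EuclideanSpace ℝ (Fin n)))
    set A := mfderiv (𝓘(ℝ, ℝ).prod (𝓡 n)) 𝓘(ℝ, ℝ) G (el x) with hA
    set B := mfderiv (𝓡 n) (𝓘(ℝ, ℝ).prod (𝓡 n)) el x with hB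
    -- `dG ∘ dẽ = 0`
    have hGel : G ∘ el = fun _ ↦ (0 : ℝ) := funext fun y ↦ (hG0 _).2 ⟨y, rfl⟩
    have hAB : A.comp B = 0 := by
      have h1 : mfderiv (𝓡 n) 𝓘(ℝ, ℝ) (G ∘ el) x = A.comp B :=
        mfderiv_comp x (hGs.mdifferentiableAt (by simp)) (hel.contMDiff.mdifferentiableAt (by simp))
      rw [← h1, hGel]
      exact mfderiv_const
    have hle : B.range ≤ LinearMap.ker (A.toLinearMap : TangentSpace (𝓘(ℝ, ℝ).prod (𝓡 n)) (el x) →ₗ[ℝ] ℝ) := by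
      rintro _ ⟨w, rfl⟩
      rw [LinearMap.mem_ker]
      have := congrArg (fun T : TangentSpace (𝓡 n) x →L[ℝ] ℝ ↦ T w) hAB
      exact this
    -- `dG ≠ 0`: `dG = dg ∘ dι` with `dι` an isomorphism and `dg ≠ 0` (regular level)
    have hA0 : (A.toLinearMap : TangentSpace (𝓘(ℝ, ℝ).prod (𝓡 n)) (el x) →ₗ[ℝ] ℝ) ≠ 0 := by
      intro hA0
      have hz : g (ι (el x)) = 0 := (hg0 _).2 ⟨x, rfl⟩
      have hreg : ¬ IsMCriticalPt (𝓡 (n + 1)) g (ι (el x)) := hg.isRegularLevel.not_isMCriticalPt hz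
      apply hreg
      change mfderiv (𝓡 (n + 1)) 𝓘(ℝ, ℝ) g (ι (el x)) = 0
      have hchain : A = (mfderiv (𝓡 (n + 1)) 𝓘(ℝ, ℝ) g (ι (el x))).comp
          (mfderiv (𝓘(ℝ, ℝ).prod (𝓡 n)) (𝓡 (n + 1)) ι (el x)) :=
        mfderiv_comp (el x) (hgs.mdifferentiableAt (by simp)) (hιs.mdifferentiableAt (by simp))
      -- `dι` is surjective (injective between spaces of the same dimension)
      have hsurj : Surjective (mfderiv (𝓘(ℝ, ℝ).prod (𝓡 n)) (𝓡 (n + 1)) ι (el x)) := by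
        have hinj := CylinderToSphere.injective_mfderiv_map n (el x)
        have hdimeq : finrank ℝ (TangentSpace (𝓘(ℝ, ℝ).prod (𝓡 n)) (el x)) =
            finrank ℝ (TangentSpace (𝓡 (n + 1)) (ι (el x))) := by
          change finrank ℝ (ℝ × EuclideanSpace ℝ (Fin n)) = finrank ℝ (EuclideanSpace ℝ (Fin (n + 1)))
          rw [finrank_prod, Module.finrank_self, finrank_euclideanSpace_fin, finrank_euclideanSpace_fin]
          omega
        have key := (LinearMap.injective_iff_surjective_of_finrank_eq_finrank hdimeq
          (f := (mfderiv (𝓘(ℝ, ℝ).prod (𝓡 n)) (𝓡 (n + 1)) ι (el x)).toLinearMap)).1 hinj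
        exact key
      ext w
      obtain ⟨u, rfl⟩ := hsurj w
      have h1 : A u = 0 := by
        have := congrArg (fun T : TangentSpace (𝓘(ℝ, ℝ).prod (𝓡 n)) (el x) →ₗ[ℝ] ℝ ↦ T u) hA0
        exact this
      rw [hchain] at h1
      exact h1
    -- dimension count
    have hBinj : Injective B := mfderiv_injective_of_isImmersion hel.isImmersion (by simp) x
    have hdim : finrank ℝ B.range + 1 =
        finrank ℝ (TangentSpace (𝓘(ℝ, ℝ).prod (𝓡 n)) (el x)) := by
      rw [LinearMap.finrank_range_of_inj (f := (B : TangentSpace (𝓡 n) x →ₗ[ℝ]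
        TangentSpace (𝓘(ℝ, ℝ).prod (𝓡 n)) (el x))) hBinj]
      change finrank ℝ (EuclideanSpace ℝ (Fin n)) + 1 = finrank ℝ (ℝ × EuclideanSpace ℝ (Fin n))
      rw [finrank_prod, Module.finrank_self, finrank_euclideanSpace_fin]
      omega
    have hker := ker_eq_of_le_of_finrank hA0 hle hdim
    constructor
    · intro hv
      exact hker.le (LinearMap.mem_ker.2 hv)
    · intro hv
      exact LinearMap.mem_ker.1 (hker.ge hv)
  · -- ### the `+∞` end: `σ₊ G > 0` eventually
    have hopen : IsOpen {z : Metric.sphere (0 : EuclideanSpace ℝ (Fin (n + 1 + 1))) 1 | 0 < σp * g z} :=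
      isOpen_lt continuous_const (continuous_const.mul hgc)
    have hmem : CylinderToSphere.northPole n ∈
        {z : Metric.sphere (0 : EuclideanSpace ℝ (Fin (n + 1 + 1))) 1 | 0 < σp * g z} := by
      show 0 < σp * g (CylinderToSphere.northPole n)
      rw [← hσp]
      exact mul_self_pos.2 hσp0
    obtain ⟨ε, hε, hball⟩ := Metric.isOpen_iff.1 hopen _ hmem
    obtain ⟨T, hT⟩ := CylinderToSphere.dist_map_northPole_lt n hε
    exact ⟨T, fun q hq ↦ hball (hT q hq)⟩
  · -- ### the `-∞` end
    have hopen : IsOpen {z : Metric.sphere (0 : EuclideanSpace ℝ (Fin (n + 1 + 1))) 1 | 0 < σm * g z} :=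
      isOpen_lt continuous_const (continuous_const.mul hgc)
    have hmem : CylinderToSphere.southPole n ∈
        {z : Metric.sphere (0 : EuclideanSpace ℝ (Fin (n + 1 + 1))) 1 | 0 < σm * g z} := by
      show 0 < σm * g (CylinderToSphere.southPole n)
      rw [← hσm]
      exact mul_self_pos.2 hσm0
    obtain ⟨ε, hε, hball⟩ := Metric.isOpen_iff.1 hopen _ hmem
    obtain ⟨T, hT⟩ := CylinderToSphere.dist_map_southPole_lt n hε
    exact ⟨T, fun q hq ↦ hball (hT q hq)⟩
  · -- ### same signs at the poles: `{σ₊ G ≤ 0}` is bounded in `t`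
    set Z : Set (Metric.sphere (0 : EuclideanSpace ℝ (Fin (n + 1 + 1))) 1) :=
      {z | σp * g z ≤ 0} with hZ
    have hZc : IsClosed Z := isClosed_le (continuous_const.mul hgc) continuous_const
    have hZk : IsCompact Z := hZc.isCompact
    have hNZ : CylinderToSphere.northPole n ∉ Z := by
      show ¬ (σp * g (CylinderToSphere.northPole n) ≤ 0)
      rw [← hσp, not_le]
      exact mul_self_pos.2 hσp0
    have hSZ : CylinderToSphere.southPole n ∉ Z := by
      show ¬ (σp * g (CylinderToSphere.southPole n) ≤ 0)
      rw [← hσm, not_le]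
      exact hsame
    -- positive distances from `Z` to the poles
    obtain ⟨ε₁, hε₁, hfar₁⟩ : ∃ ε > 0, ∀ z ∈ Z, ε ≤ dist z (CylinderToSphere.northPole n) := by
      by_cases hZe : Z.Nonempty
      · obtain ⟨z₀, hz₀, hmin⟩ :=
          hZk.exists_isMinOn hZe (continuous_id.dist continuous_const).continuousOn
        refine ⟨dist z₀ (CylinderToSphere.northPole n), dist_pos.2 (fun h ↦ hNZ (h ▸ hz₀)),
          fun z hz ↦ (isMinOn_iff.1 hmin) z hz⟩
      · exact ⟨1, one_pos, fun z hz ↦ (hZe ⟨z, hz⟩).elim⟩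
    obtain ⟨ε₂, hε₂, hfar₂⟩ : ∃ ε > 0, ∀ z ∈ Z, ε ≤ dist z (CylinderToSphere.southPole n) := by
      by_cases hZe : Z.Nonempty
      · obtain ⟨z₀, hz₀, hmin⟩ :=
          hZk.exists_isMinOn hZe (continuous_id.dist continuous_const).continuousOn
        refine ⟨dist z₀ (CylinderToSphere.southPole n), dist_pos.2 (fun h ↦ hSZ (h ▸ hz₀)),
          fun z hz ↦ (isMinOn_iff.1 hmin) z hz⟩
      · exact ⟨1, one_pos, fun z hz ↦ (hZe ⟨z, hz⟩).elim⟩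
    obtain ⟨T₁, hT₁⟩ := CylinderToSphere.dist_map_northPole_lt n hε₁
    obtain ⟨T₂, hT₂⟩ := CylinderToSphere.dist_map_southPole_lt n hε₂
    refine ⟨max |T₁| |T₂|, fun q hq ↦ ?_⟩
    have hqZ : ι q ∈ Z := hq
    rw [abs_le]
    constructor
    · -- `q.1 ≥ -max`: otherwise `q.1 ≤ T₂` and `ι q` would be close to the south pole
      by_contra hlt
      push Not at hlt
      have h1 : q.1 ≤ T₂ := by
        have : -max |T₁| |T₂| ≤ -|T₂| := neg_le_neg (le_max_right _ _)
        linarith [neg_abs_le T₂]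
      exact absurd (hfar₂ _ hqZ) (not_le.2 (hT₂ q h1))
    · by_contra hlt
      push Not at hlt
      have h1 : T₁ ≤ q.1 := by
        have : |T₁| ≤ max |T₁| |T₂| := le_max_left _ _
        linarith [le_abs_self T₁]
      exact absurd (hfar₁ _ hqZ) (not_le.2 (hT₁ q h1))

end BudneyGabai2019_thm_3_13

end Literature.Topology.FourManifolds

end
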